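import Mathlib
import HarnessLib
import Literature.MathematicalPhysics.KineticTheory.LangevinChainGibbs
import Summits.AtomisticToContinuum.FouriersLaw.Theorems.JunctionLocalityInsertionRemoveCutoff
import Summits.AtomisticToContinuum.FouriersLaw.Theorems.JunctionLocalityInsertionMollify
import Summits.AtomisticToContinuum.FouriersLaw.Theorems.JunctionLocalityInsertionGibbsProduct

/-!
# Insertion identity toolbox, VII: the weak equation paired with a non-compactly-supported field; the skeleton's observables

Support file for stub `stub_insertionIdentity` (line `thermalise-then-cut-probe-insertion`, crux
`stmt-AtomisticToContinuum-11748`). (P1) If `h, W ∈ L²(μ_T)` satisfy `∫ (𝓛_c φ) h = −∫ φ W` for all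
`C^m_c` test functions (`2 ≤ m ≤ ∞`), the identity holds tested against every `g ∈ C^m` with
`g, 𝓛_c g ∈ L²` and `∂_{p_i} g ∈ L²` on the weighted sites (cut off `g`, expand `𝓛_c(χ_n g)`, remove
the cutoff). Then the line's vocabulary written out (`kin`, `thermo`, `junctionOU`, the device
generator, `plainSource`: the bodies of the skeleton's definitions written out verbatim, so the
final stub file applies everything by definitional unfolding): bridges to
the weighted forms, smoothness and `L²` bounds of the polynomial observables. All [folklore].
No definitions.
-/

noncomputable section

open scoped ContDiff Topology ENNReal NNReal Convolution Pointwise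
open MeasureTheory ProbabilityTheory Filter Set Function
open Literature.MathematicalPhysics.KineticTheory.HeatConduction

namespace Summit.AtomisticToContinuum.FouriersLaw.Cruxes.SuperadditiveResistance.InsertionToolbox

local notation "uP" i' => ((0, Pi.single i' 1) : PhaseSpace _)
local notation "uQ" i' => ((Pi.single i' 1, 0) : PhaseSpace _)

local notation "OU⟦" T' ";" i' ";" f' ";" x' "⟧" =>
  T' * partialP i' (partialP i' f') x' - Prod.snd (x' : PhaseSpace _) i' * partialP i' f' x'
local notation "XH⟦" P' ";" f' ";" x' "⟧" =>
  ∑ i, (Prod.snd (x' : PhaseSpace _) i * partialQ i f' x' -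
    partialQ i (OscillatorChain.hamiltonian P' _) x' * partialP i f' x')
local notation "GEN⟦" P' ";" T' ";" c' ";" f' ";" x' "⟧" =>
  XH⟦P' ; f' ; x'⟧ + ∑ i, c' i * OU⟦T' ; i ; f' ; x'⟧
local notation "CUT⟦" ω₂' ";" lam' ";" β' ";" γ' ";" n' ";" x' "⟧" =>
  Real.smoothTransition (2 - OscillatorChain.hamiltonian (pinnedChain ω₂' lam' β' γ') _ x' / ((n' : ℝ) + 1))

variable {L : ℕ}

section Pairings

variable {ω₂ lam β : ℝ}

set_option hygiene false in
local notation "Pch" => pinnedChain ω₂ lam β γ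
set_option hygiene false in
local notation "μ♭" => OscillatorChain.gibbsMeasure (pinnedChain ω₂ lam β γ) L T
set_option hygiene false in
local notation "ρ♭" => OscillatorChain.gibbsDensity (pinnedChain ω₂ lam β γ) L T
set_option hygiene false in
local notation "χ⟦" n' "⟧" => fun y : PhaseSpace L => CUT⟦ω₂ ; lam ; β ; γ ; n' ; y⟧
local notation "SC⟦" T' ";" c' ";" f' ";" x' "⟧" => ∑ i, c' i * OU⟦T' ; i ; f' ; x'⟧

/-- **Pairing P1: the weak equation tested against a non-compactly-supported field.** Let `h, W ∈
L²(μ_T)` satisfy the weak equation `∫ (𝓛_c φ) h dμ_T = −∫ φ W dμ_T` for all `C^m` compactly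
supported `φ` (`2 ≤ m ≤ ∞`). Then the same identity holds for every `g ∈ C^m` with
`g, 𝓛_c g ∈ L²(μ_T)` and `∂_{p_i} g ∈ L²(μ_T)` whenever `c_i ≠ 0` (cut off `g`, expand `𝓛_c(χ_n g)`,
remove the cutoff). [folklore] -/
theorem pinnedChain_weak_pairing (hω : 0 < ω₂) (hl : 0 ≤ lam) (hβ : 0 ≤ β) (γ : ℝ) (L : ℕ)
    (T : ℝ) (c : Fin L → ℝ) {m : ℕ∞} (hm : 2 ≤ m) {h W : PhaseSpace L → ℝ}
    (hh : MemLp h 2 μ♭) (hW : MemLp W 2 μ♭)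
    (hweak : ∀ φ : PhaseSpace L → ℝ, ContDiff ℝ (m : WithTop ℕ∞) φ → HasCompactSupport φ →
      ∫ x, GEN⟦Pch ; T ; c ; φ ; x⟧ * h x ∂μ♭ = -∫ x, φ x * W x ∂μ♭)
    {g : PhaseSpace L → ℝ} (hg : ContDiff ℝ (m : WithTop ℕ∞) g) (hgL2 : MemLp g 2 μ♭)
    (hGg : MemLp (fun x : PhaseSpace L => GEN⟦Pch ; T ; c ; g ; x⟧) 2 μ♭)
    (hdg : ∀ i, c i ≠ 0 → MemLp (partialP i g) 2 μ♭) :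
    ∫ x, GEN⟦Pch ; T ; c ; g ; x⟧ * h x ∂μ♭ = -∫ x, g x * W x ∂μ♭ := by
  have hm2 : ((2 : ℕ∞) : WithTop ℕ∞) ≤ (m : WithTop ℕ∞) := by exact_mod_cast hm
  have hg2 : ContDiff ℝ 2 g := hg.of_le hm2
  have hGh : Integrable (fun x : PhaseSpace L => GEN⟦Pch ; T ; c ; g ; x⟧ * h x) μ♭ := hGg.integrable_mul hh
  have hgh : Integrable (fun x : PhaseSpace L => g x * h x) μ♭ := hgL2.integrable_mul hh
  have hgW : Integrable (fun x : PhaseSpace L => g x * W x) μ♭ := hgL2.integrable_mul hW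
  have hdgh : ∀ i, c i ≠ 0 → Integrable (fun x : PhaseSpace L => partialP i g x * h x) μ♭ :=
    fun i hi => (hdg i hi).integrable_mul hh
  -- (1) the weak equation for `χ_n g`
  have h1 : ∀ n : ℕ, ∫ x, GEN⟦Pch ; T ; c ; fun y => CUT⟦ω₂ ; lam ; β ; γ ; n ; y⟧ * g y ; x⟧ * h x ∂μ♭ =
      -∫ x, CUT⟦ω₂ ; lam ; β ; γ ; n ; x⟧ * (g x * W x) ∂μ♭ := by
    intro n
    have hχm : ContDiff ℝ (m : WithTop ℕ∞) fun y : PhaseSpace L => CUT⟦ω₂ ; lam ; β ; γ ; n ; y⟧ :=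
      (contDiff_cutoff ω₂ lam β γ L n).of_le (by exact_mod_cast le_top)
    rw [hweak _ (hχm.mul hg) ((hasCompactSupport_cutoff hω hl hβ γ L n).mul_right)]
    congr 1
    exact integral_congr_ae (ae_of_all _ fun x => by ring)
  -- (2) limits
  have hlimL : Tendsto (fun n : ℕ => ∫ x, CUT⟦ω₂ ; lam ; β ; γ ; n ; x⟧ * (GEN⟦Pch ; T ; c ; g ; x⟧ * h x) ∂μ♭)
      atTop (𝓝 (∫ x, GEN⟦Pch ; T ; c ; g ; x⟧ * h x ∂μ♭)) := tendsto_integral_cutoff_mul γ L _ hGh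
  have hlimW : Tendsto (fun n : ℕ => -∫ x, CUT⟦ω₂ ; lam ; β ; γ ; n ; x⟧ * (g x * W x) ∂μ♭)
      atTop (𝓝 (-∫ x, g x * W x ∂μ♭)) := (tendsto_integral_cutoff_mul γ L _ hgW).neg
  have hlim2 := tendsto_integral_ouSum_cutoff_mul hω hl hβ γ L T c μ♭ hgh
  have hlim3 := tendsto_sum_weight_partialP_cutoff_mul hω hl hβ γ L c μ♭
    (Φ := fun i x => partialP i g x * h x) hdgh
  -- (3) the identity for each `n`: expand `𝓛(χ_n g)`
  have hn : ∀ n : ℕ, ∫ x, CUT⟦ω₂ ; lam ; β ; γ ; n ; x⟧ * (GEN⟦Pch ; T ; c ; g ; x⟧ * h x) ∂μ♭ =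
      (-∫ x, CUT⟦ω₂ ; lam ; β ; γ ; n ; x⟧ * (g x * W x) ∂μ♭) -
        (∫ x, SC⟦T ; c ; χ⟦n⟧ ; x⟧ * (g x * h x) ∂μ♭) -
        2 * T * ∑ i, c i * ∫ x, partialP i χ⟦n⟧ x * (partialP i g x * h x) ∂μ♭ := by
    intro n
    rw [← h1 n]
    have e : ∀ x : PhaseSpace L, GEN⟦Pch ; T ; c ; fun y => CUT⟦ω₂ ; lam ; β ; γ ; n ; y⟧ * g y ; x⟧ * h x =
        CUT⟦ω₂ ; lam ; β ; γ ; n ; x⟧ * (GEN⟦Pch ; T ; c ; g ; x⟧ * h x) +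
          SC⟦T ; c ; χ⟦n⟧ ; x⟧ * (g x * h x) +
          2 * T * ∑ i, c i * (partialP i χ⟦n⟧ x * (partialP i g x * h x)) := by
      intro x
      rw [gen_mul (Pch) c (contDiff_cutoff_nat ω₂ lam β γ L n 2) hg2 x, liouville_cutoff, zero_add]
      have hC : (2 * T * ∑ i, c i * (partialP i χ⟦n⟧ x * partialP i g x)) * h x =
          2 * T * ∑ i, c i * (partialP i χ⟦n⟧ x * (partialP i g x * h x)) := by
        rw [mul_assoc, Finset.sum_mul]
        congr 1
        exact Finset.sum_congr rfl fun i _ => by ring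
      rw [add_mul, add_mul, hC]
      ring
    have eI : ∫ x, GEN⟦Pch ; T ; c ; fun y => CUT⟦ω₂ ; lam ; β ; γ ; n ; y⟧ * g y ; x⟧ * h x ∂μ♭ =
        (∫ x, CUT⟦ω₂ ; lam ; β ; γ ; n ; x⟧ * (GEN⟦Pch ; T ; c ; g ; x⟧ * h x) ∂μ♭) +
          (∫ x, SC⟦T ; c ; χ⟦n⟧ ; x⟧ * (g x * h x) ∂μ♭) +
          2 * T * ∑ i, c i * ∫ x, partialP i χ⟦n⟧ x * (partialP i g x * h x) ∂μ♭ := by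
      simp only [e]
      have hA : Integrable (fun x : PhaseSpace L => CUT⟦ω₂ ; lam ; β ; γ ; n ; x⟧ * (GEN⟦Pch ; T ; c ; g ; x⟧ * h x)) μ♭ :=
        hGh.bdd_mul (contDiff_cutoff_nat ω₂ lam β γ L n 0).continuous.aestronglyMeasurable
          (ae_of_all _ fun x => by
            have h := cutoff_mem_Icc ω₂ lam β γ L n x
            rw [Real.norm_eq_abs, abs_of_nonneg h.1]; exact h.2)
      have hB := integrable_ouSum_cutoff_mul hω hl hβ γ L T c μ♭ n hgh
      have hC3 : Integrable (fun x : PhaseSpace L =>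
          ∑ i, c i * (partialP i χ⟦n⟧ x * (partialP i g x * h x))) μ♭ :=
        integrable_finsetSum _ fun i _ =>
          integrable_weight_partialP_cutoff_mul hω hl hβ γ L T c μ♭ n i (hdgh i)
      have hAB : Integrable (fun x : PhaseSpace L => CUT⟦ω₂ ; lam ; β ; γ ; n ; x⟧ * (GEN⟦Pch ; T ; c ; g ; x⟧ * h x) +
          SC⟦T ; c ; χ⟦n⟧ ; x⟧ * (g x * h x)) μ♭ := hA.add hB
      have hC3' : Integrable (fun x : PhaseSpace L =>
          2 * T * ∑ i, c i * (partialP i χ⟦n⟧ x * (partialP i g x * h x))) μ♭ := hC3.const_mul (2 * T)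
      rw [integral_add hAB hC3', integral_add hA hB, integral_const_mul,
        integral_finsetSum _ fun i _ =>
          integrable_weight_partialP_cutoff_mul hω hl hβ γ L T c μ♭ n i (hdgh i)]
      congr 1
      congr 1
      exact Finset.sum_congr rfl fun i _ => integral_const_mul _ _
    linarith [eI]
  have hlimR : Tendsto (fun n : ℕ => ∫ x, CUT⟦ω₂ ; lam ; β ; γ ; n ; x⟧ * (GEN⟦Pch ; T ; c ; g ; x⟧ * h x) ∂μ♭)
      atTop (𝓝 ((-∫ x, g x * W x ∂μ♭) - 0 - 2 * T * 0)) := by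
    simp only [hn]
    exact (hlimW.sub hlim2).sub (hlim3.const_mul (2 * T))
  have := tendsto_nhds_unique hlimL hlimR
  simpa using this

end Pairings

/-! ## Assembly, part 1 (vocabulary of the skeleton written out) -/

namespace Assembly

local notation "SC⟦" T' ";" c' ";" f' ";" x' "⟧" => ∑ i, c' i * OU⟦T' ; i ; f' ; x'⟧
set_option quotPrecheck false in
local notation "KIN⟦" L' ";" s' ";" x' "⟧" =>
  (∑ i : Fin L', if i.val = s' then Prod.snd (x' : PhaseSpace L') i ^ 2 else 0)
set_option quotPrecheck false in
local notation "THERMO⟦" L' ";" s' ";" θ' ";" f' ";" x' "⟧" =>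
  (∑ i : Fin L', if i.val = s' then θ' * partialP i (partialP i f') x' -
    Prod.snd (x' : PhaseSpace L') i * partialP i f' x' else 0)
set_option quotPrecheck false in
local notation "JOU⟦" T' ";" N' ";" M' ";" f' ";" x' "⟧" =>
  (THERMO⟦N' + M' ; N' - 1 ; T' ; f' ; x'⟧ + THERMO⟦N' + M' ; N' ; T' ; f' ; x'⟧)
set_option quotPrecheck false in
local notation "EK⟦" T' ";" N' ";" M' ";" x' "⟧" =>
  ((KIN⟦N' + M' ; N' - 1 ; x'⟧ + KIN⟦N' + M' ; N' ; x'⟧) / (2 * T' ^ 2))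
set_option quotPrecheck false in
local notation "CONDK⟦" T' ";" N' ";" M' ";" f' ";" x' "⟧" =>
  (∫ ξ : Fin (N' + M') → ℝ, f' (Prod.fst (x' : PhaseSpace (N' + M')),
    fun i => if i.val = N' - 1 ∨ i.val = N' then ξ i else Prod.snd (x' : PhaseSpace (N' + M')) i)
    ∂(Measure.pi fun _ : Fin (N' + M') => gaussianReal 0 (Real.toNNReal T')))
set_option quotPrecheck false in
local notation "PSRC⟦" P' ";" T' ";" L' ";" x' "⟧" =>
  (OscillatorChain.γ P' / (2 * T' ^ 2) * (KIN⟦L' ; 0 ; x'⟧ - KIN⟦L' ; L' - 1 ; x'⟧))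

variable {L : ℕ}

/-! ### The skeleton vocabulary, written out

The line's skeleton defines `kin`, `thermo`, `junctionOU`, `deviceGenerator`, `condK`, `eK`,
`plainSource`, `curvature`, `roughness`, `IsForwardField`; this support file must stay importable
next to that (verbatim) vocabulary, so every statement below spells the bodies of those
definitions out verbatim, and the final stub file applies them by definitional unfolding.
-/

/-- `kin L s = p_s²` for `s < L`. [folklore] -/
theorem kin_eq_sq {s : ℕ} (hs : s < L) (x : PhaseSpace L) : KIN⟦L ; s ; x⟧ = x.2 ⟨s, hs⟩ ^ 2 := by
  rw [Finset.sum_eq_single ⟨s, hs⟩]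
  · simp
  · intro i _ hi
    have : i.val ≠ s := fun h => hi (Fin.ext h)
    simp [this]
  · simp

/-- `thermo` as a weighted sum of one-site thermostats. [folklore] -/
theorem thermo_eq_sum (s : ℕ) (θ : ℝ) (f : PhaseSpace L → ℝ) (x : PhaseSpace L) :
    THERMO⟦L ; s ; θ ; f ; x⟧ = ∑ i : Fin L, (if i.val = s then (1 : ℝ) else 0) * OU⟦θ ; i ; f ; x⟧ := by
  refine Finset.sum_congr rfl fun i _ => ?_
  split_ifs <;> simp

/-- The probe-pair operator `S_K` as the weighted thermostat sum with weights `𝟙_{N-1} + 𝟙_N`.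
[folklore] -/
theorem junctionOU_eq (T : ℝ) (N M : ℕ) (f : PhaseSpace (N + M) → ℝ) (x : PhaseSpace (N + M)) :
    JOU⟦T ; N ; M ; f ; x⟧ =
      SC⟦T ; fun i : Fin (N + M) =>
        (if i.val = N - 1 then (1 : ℝ) else 0) + (if i.val = N then (1 : ℝ) else 0) ; f ; x⟧ := by
  rw [thermo_eq_sum, thermo_eq_sum, ← Finset.sum_add_distrib]
  exact Finset.sum_congr rfl fun i _ => by ring

/-- The device generator at equilibrium (`L_T + γ S_K`) as the weighted generator with weights
`γ(𝟙_0 + 𝟙_{L-1}) + γ(𝟙_{N-1} + 𝟙_N)`. [folklore] -/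
theorem deviceGenerator_eq_weighted (P : OscillatorChain) (N M : ℕ) (T : ℝ)
    (f : PhaseSpace (N + M) → ℝ) (x : PhaseSpace (N + M)) :
    P.generator (N + M) T T f x + P.γ * JOU⟦T ; N ; M ; f ; x⟧ =
      GEN⟦P ; T ; fun i : Fin (N + M) =>
        P.γ * ((if i.val = 0 then 1 else 0) + (if i.val = N + M - 1 then 1 else 0)) +
          P.γ * ((if i.val = N - 1 then (1 : ℝ) else 0) + (if i.val = N then (1 : ℝ) else 0)) ; f ; x⟧ := by
  rw [generator_eq_weighted, junctionOU_eq, add_assoc, Finset.mul_sum, ← Finset.sum_add_distrib]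
  congr 1
  exact Finset.sum_congr rfl fun i _ => by ring

/-- Splitting the device weights: `𝓛_dev f = 𝓛_T f + γ S_K f`. [folklore] -/
theorem gen_device_split (P : OscillatorChain) (N M : ℕ) (T : ℝ)
    (f : PhaseSpace (N + M) → ℝ) (x : PhaseSpace (N + M)) :
    GEN⟦P ; T ; fun i : Fin (N + M) =>
        P.γ * ((if i.val = 0 then 1 else 0) + (if i.val = N + M - 1 then 1 else 0)) +
          P.γ * ((if i.val = N - 1 then (1 : ℝ) else 0) + (if i.val = N then (1 : ℝ) else 0)) ; f ; x⟧ =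
      GEN⟦P ; T ; fun i : Fin (N + M) =>
        P.γ * ((if i.val = 0 then 1 else 0) + (if i.val = N + M - 1 then 1 else 0)) ; f ; x⟧ +
        P.γ * SC⟦T ; fun i : Fin (N + M) =>
          (if i.val = N - 1 then (1 : ℝ) else 0) + (if i.val = N then (1 : ℝ) else 0) ; f ; x⟧ := by
  conv_rhs => rw [add_assoc, Finset.mul_sum, ← Finset.sum_add_distrib]
  congr 1
  exact Finset.sum_congr rfl fun i _ => by ring

/-! ### Polynomial observables: `kin`, `eK`, `plainSource`, and `S_K e_K` -/

/-- `∂_{p_i} p_a² = 2 p_a δ_{ia}`. [folklore] -/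
theorem partialP_sq_coord (i a : Fin L) (x : PhaseSpace L) :
    partialP i (fun y : PhaseSpace L => y.2 a ^ 2) x = if a = i then 2 * x.2 a else 0 := by
  rw [partialP_comp (φ := fun t : ℝ => t ^ 2) (f := fun y : PhaseSpace L => y.2 a) (differentiable_pow 2)
    ((contDiff_snd_apply a (n := 1)).differentiable one_ne_zero), partialP_snd]
  simp only [deriv_pow_field, Nat.cast_ofNat]
  split_ifs <;> ring

/-- `S_i p_a² = δ_{ia} (2T − 2p_a²)`. [folklore] -/
theorem ou_sq_coord (T : ℝ) (i a : Fin L) (x : PhaseSpace L) :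
    OU⟦T ; i ; fun y : PhaseSpace L => y.2 a ^ 2 ; x⟧ = if a = i then 2 * T - 2 * x.2 a ^ 2 else 0 := by
  have h1 : partialP i (fun y : PhaseSpace L => y.2 a ^ 2) = fun y : PhaseSpace L =>
      if a = i then 2 * y.2 a else 0 := funext fun y => partialP_sq_coord i a y
  rw [h1]
  by_cases hai : a = i
  · subst hai
    simp only [if_true]
    rw [partialP_const_mul ((contDiff_snd_apply a (n := 1)).differentiable one_ne_zero),
      partialP_snd]
    simp only [if_true]
    ring
  · simp [hai]

/-- `kin L s` is the smooth function `p_s²` (`s < L`). [folklore] -/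
theorem kin_eq_fun {s : ℕ} (hs : s < L) : (fun x : PhaseSpace L => KIN⟦L ; s ; x⟧) = fun x : PhaseSpace L => x.2 ⟨s, hs⟩ ^ 2 :=
  funext fun x => kin_eq_sq hs x

/-- `kin L s` is smooth. [folklore] -/
theorem contDiff_kin (s : ℕ) {n : WithTop ℕ∞} : ContDiff ℝ n (fun x : PhaseSpace L => KIN⟦L ; s ; x⟧) := by
  refine ContDiff.sum fun i _ => ?_
  split_ifs
  · exact (contDiff_snd_apply i).pow 2
  · exact contDiff_const

/-- `0 ≤ kin L s ≤ 2H` for the pinned chain. [folklore] -/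
theorem kin_le_two_mul_hamiltonian {ω₂ lam β : ℝ} (hω : 0 ≤ ω₂) (hl : 0 ≤ lam) (hβ : 0 ≤ β)
    (γ : ℝ) (s : ℕ) (x : PhaseSpace L) :
    0 ≤ KIN⟦L ; s ; x⟧ ∧ KIN⟦L ; s ; x⟧ ≤ 2 * (pinnedChain ω₂ lam β γ).hamiltonian L x := by
  by_cases hs : s < L
  · rw [kin_eq_sq hs]
    exact ⟨sq_nonneg _, by linarith [pinnedChain_sq_le_hamiltonian hω hl hβ γ L x ⟨s, hs⟩]⟩
  · have : KIN⟦L ; s ; x⟧ = 0 := by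
      exact Finset.sum_eq_zero fun i _ => by
        have : i.val ≠ s := fun h => hs (h ▸ i.isLt)
        simp [this]
    rw [this]
    exact ⟨le_rfl, by linarith [pinnedChain_hamiltonian_nonneg hω hl hβ γ L x]⟩

/-- `kin L s − T ∈ L²(μ_T)` (and hence `kin L s ∈ L²(μ_T)`). [folklore] -/
theorem memLp_kin_sub {ω₂ lam β : ℝ} (hω : 0 < ω₂) (hl : 0 ≤ lam) (hβ : 0 ≤ β) (γ : ℝ) (L : ℕ)
    {T : ℝ} (hT : 0 < T) (s : ℕ) (a : ℝ) :
    MemLp (fun x : PhaseSpace L => KIN⟦L ; s ; x⟧ - a) 2 ((pinnedChain ω₂ lam β γ).gibbsMeasure L T) := by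
  refine pinnedChain_memLp_two_of_abs_le hω hl hβ γ L hT ((contDiff_kin s (n := 0)).continuous.sub
    continuous_const) (C := 2 + |a|) (k := 1) fun x => ?_
  have h := kin_le_two_mul_hamiltonian hω.le hl hβ γ s x (L := L)
  have hH := pinnedChain_hamiltonian_nonneg hω.le hl hβ γ L x
  rw [pow_one]
  calc |KIN⟦L ; s ; x⟧ - a| ≤ |KIN⟦L ; s ; x⟧| + |a| := abs_sub _ _
    _ = KIN⟦L ; s ; x⟧ + |a| := by rw [abs_of_nonneg h.1]
    _ ≤ (2 + |a|) * (1 + (pinnedChain ω₂ lam β γ).hamiltonian L x) := by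
        nlinarith [abs_nonneg a]

/-! ### Cauchy–Schwarz at the junction -/

section JunctionCS

variable {ω₂ lam β : ℝ}

set_option hygiene false in
local notation "Pch" => pinnedChain ω₂ lam β γ
set_option hygiene false in
local notation "μ♭" => OscillatorChain.gibbsMeasure (pinnedChain ω₂ lam β γ) (N + M) T

/-- `e_K ∈ L²(μ_T)`. [folklore] -/
theorem memLp_eK (hω : 0 < ω₂) (hl : 0 ≤ lam) (hβ : 0 ≤ β) (γ : ℝ) (N M : ℕ) {T : ℝ} (hT : 0 < T) :
    MemLp (fun x : PhaseSpace (N + M) => EK⟦T ; N ; M ; x⟧) 2 μ♭ := by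
  have e : (fun x : PhaseSpace (N + M) => EK⟦T ; N ; M ; x⟧) =
      fun x => (1 / (2 * T ^ 2)) * ((KIN⟦N + M ; N - 1 ; x⟧ - 0) + (KIN⟦N + M ; N ; x⟧ - 0)) := by
    funext x; ring
  rw [e]
  exact ((memLp_kin_sub hω hl hβ γ (N + M) hT (N - 1) 0).add
    (memLp_kin_sub hω hl hβ γ (N + M) hT N 0)).const_mul _

/-- **Cauchy–Schwarz at the junction.** If `S_K u ∈ L²(μ_T)` is orthogonal to the range of `Π_K`,
then for `h ∈ L²(μ_T)` and every `θ`: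
`(⟨S_K u, h⟩ − θ⟨S_K u, e_K⟩)² ≤ ‖S_K u‖² · ‖(I − Π_K)(h − θ e_K)‖²` (= curvature × roughness).
[folklore] -/
theorem junction_cs (hω : 0 < ω₂) (hl : 0 ≤ lam) (hβ : 0 ≤ β) (γ : ℝ) (N M : ℕ) {T : ℝ} (hT : 0 < T)
    {u : PhaseSpace (N + M) → ℝ} (hSu : MemLp (fun x : PhaseSpace (N + M) => JOU⟦T ; N ; M ; u ; x⟧) 2 μ♭)
    {h : PhaseSpace (N + M) → ℝ} (hh : MemLp h 2 μ♭) (θ : ℝ)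
    (hP3 : ∀ f : PhaseSpace (N + M) → ℝ, MemLp f 2 μ♭ →
      ∫ x, JOU⟦T ; N ; M ; u ; x⟧ * CONDK⟦T ; N ; M ; f ; x⟧ ∂μ♭ = 0) :
    ((∫ x, JOU⟦T ; N ; M ; u ; x⟧ * h x ∂μ♭) - θ * ∫ x, JOU⟦T ; N ; M ; u ; x⟧ * EK⟦T ; N ; M ; x⟧ ∂μ♭) ^ 2 ≤
      (∫ x, JOU⟦T ; N ; M ; u ; x⟧ ^ 2 ∂μ♭) *
        ∫ x, ((h x - θ * EK⟦T ; N ; M ; x⟧) -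
          CONDK⟦T ; N ; M ; fun y : PhaseSpace (N + M) => h y - θ * EK⟦T ; N ; M ; y⟧ ; x⟧) ^ 2 ∂μ♭ := by
  haveI := pinnedChain_isProbabilityMeasure_gibbsMeasure hω hl hβ γ (N + M) hT
  set f : PhaseSpace (N + M) → ℝ := fun x => h x - θ * EK⟦T ; N ; M ; x⟧ with hf_def
  have hf : MemLp f 2 μ♭ := hh.sub ((memLp_eK hω hl hβ γ N M hT).const_mul θ)
  have hPi := (memLp_condK_and_integral_sq_le hω hl hβ γ (N + M) hT
    (fun i : Fin (N + M) => i.val = N - 1 ∨ i.val = N) hf).1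
  have hPi' : MemLp (fun x : PhaseSpace (N + M) => CONDK⟦T ; N ; M ; f ; x⟧) 2 μ♭ := hPi
  -- linearity: `⟨S u, h⟩ - θ⟨S u, e_K⟩ = ⟨S u, f⟩ = ⟨S u, f - Π f⟩`
  have hSh : Integrable (fun x => JOU⟦T ; N ; M ; u ; x⟧ * h x) μ♭ := hSu.integrable_mul hh
  have hSe : Integrable (fun x => JOU⟦T ; N ; M ; u ; x⟧ * EK⟦T ; N ; M ; x⟧) μ♭ :=
    hSu.integrable_mul (memLp_eK hω hl hβ γ N M hT)
  have hSf : Integrable (fun x => JOU⟦T ; N ; M ; u ; x⟧ * f x) μ♭ := hSu.integrable_mul hf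
  have hSPf : Integrable (fun x => JOU⟦T ; N ; M ; u ; x⟧ * CONDK⟦T ; N ; M ; f ; x⟧) μ♭ := hSu.integrable_mul hPi'
  have e1 : (∫ x, JOU⟦T ; N ; M ; u ; x⟧ * h x ∂μ♭) - θ * ∫ x, JOU⟦T ; N ; M ; u ; x⟧ * EK⟦T ; N ; M ; x⟧ ∂μ♭ =
      ∫ x, JOU⟦T ; N ; M ; u ; x⟧ * f x ∂μ♭ := by
    rw [← integral_const_mul, ← integral_sub hSh (hSe.const_mul θ)]
    exact integral_congr_ae (ae_of_all _ fun x => by simp only [hf_def]; ring)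
  have e2 : ∫ x, JOU⟦T ; N ; M ; u ; x⟧ * f x ∂μ♭ =
      ∫ x, JOU⟦T ; N ; M ; u ; x⟧ * (f x - CONDK⟦T ; N ; M ; f ; x⟧) ∂μ♭ := by
    have h0 := hP3 f hf
    have hs := integral_sub hSf hSPf
    rw [h0, sub_zero] at hs
    rw [← hs]
    exact integral_congr_ae (ae_of_all _ fun x => by ring)
  rw [e1, e2]
  -- Cauchy–Schwarz
  exact sq_integral_mul_le (ν := μ♭) hSu (hf.sub hPi')

end JunctionCS

end Assembly

/-- Registered helper stub of this support file: the kinetic observable of the skeleton (`kin`, written out) is `p_s²`. [folklore] -/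
theorem helper_insertionWeakPairing : ∀ {L s : ℕ} (hs : s < L) (x : PhaseSpace L), (∑ i : Fin L, if i.val = s then x.2 i ^ 2 else 0) = x.2 ⟨s, hs⟩ ^ 2 := by
  intro L s hs x
  exact Assembly.kin_eq_sq hs x

end Summit.AtomisticToContinuum.FouriersLaw.Cruxes.SuperadditiveResistance.InsertionToolbox

end
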